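import Summits.SmoothPoincare4.SmoothPoincare4.Theorems.ConvexBisectionAcyclicBisectionExistsChartedChainScale
import Summits.SmoothPoincare4.SmoothPoincare4.Theorems.ConvexBisectionAcyclicBisectionExistsPageTwistingTransverse
import Summits.SmoothPoincare4.SmoothPoincare4.Theorems.ConvexBisectionAcyclicBisectionExistsPicardLefschetzPieces
import Literature.Topology.FourManifolds.RegularDomainMaps
import Mathlib.Analysis.SpecialFunctions.Trigonometric.Deriv
import HarnessLib

/-!
# The charted vanishing cycle of a page over the symmetric chord
(wave 4, brick Y4-2c of the model chain (R2) `exists_charted_chain` for the missing lemma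
`crossingNumber_eq_stdSymp` of node N1a of stub `stub_modelsOnFibred_of_reach` = NF4, line
`modp-braid-orbits`, crux `ConvexBisection.AcyclicBisectionExists`, item stmt-SmoothPoincare4-10508;
registered sub-goal `helper_cycleChart_mem_page`)

With the Joukowski uniformisation `t ↦ (jX t, jY t)` of the central page around the symmetric
chord `[ζ_{2g}, ζ_0]` (`…ChartedChainBranch.lean`) and the page scaling `pagePt g c`
(`…ChartedChainScale.lean`), the ANNULUS CHART of node N1a around the vanishing cycle of the page
`page g c` (`‖c‖ ≤ 1`) is

  `cycleChart (u, r) = pagePt g c (jX t, jY t)`,  `t = tParam g (u, r) = radP g r · e^{2πiu}`,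

with the radial profile `radP g r = 1 + (2 − sin(πr/2))/(12(2g+1)) ∈ [1 + 1/(12n), 1 + 1/(4n)]`,
DECREASING in `r` (which is the orientation making `⟪∂ᵣ, i ∂ᵤ⟫ > 0`).  This file defines it and
proves the derivative-free chart hypotheses: values in `page g c` (`helper_cycleChart_mem_page`),
`1`-periodicity, injectivity on `[0,1) × [−1,1]` (Joukowski injectivity: `jX s = jX t` forces
`s = t` or `s = t⁻¹`, and `‖t‖ > 1`), continuity and real smoothness of the ambient map
(`contDiff_cycleAmb`: `jX`, `jY` are holomorphic on the strip `cos θ_1 < Re jX`, which contains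
the annulus `1 ≤ ‖t‖ ≤ 1 + 1/(2g+1)`), smoothness into the base (`contMDiff_cycleChart`), the
core circle, and `tParam g (1/4, r) = i · radP g r` (the imaginary axis, where the chart meets the
perpendicular bisector of the chord on the LOWER sheet).  The orientation is the sequel.
Everything is proved; no `sorry`.  References: J. Milnor, *Singular points of complex
hypersurfaces* (1968), §9 [Milnor1968].
-/

noncomputable section

set_option linter.dupNamespace false

open scoped Manifold ContDiff Topology ComplexConjugate Real
open Set Function Metric Complex
open Literature.Topology.FourManifolds Literature.Topology.FourManifolds.LefschetzBase

namespace Summit.SmoothPoincare4.SmoothPoincare4.Theorems.AcyclicBisectionExists.ModpBraidOrbits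

variable {g : ℕ} {c : ℂ}

/-! ## §1 The radial profile -/

/-- **The radial profile** `radP g r = 1 + (2 − sin(πr/2))/(12(2g+1))`, decreasing on `[−1, 1]`
from `1 + 1/(4(2g+1))` to `1 + 1/(12(2g+1))`. [folklore] -/
def radP (g : ℕ) (r : ℝ) : ℝ := 1 + (2 - Real.sin (π * r / 2)) / (12 * (2 * g + 1))

/-- Lower bound `radP ≥ 1 + 1/(12(2g+1))`. [folklore] -/
theorem radP_ge (g : ℕ) (r : ℝ) : 1 + 1 / (12 * (2 * g + 1)) ≤ radP g r := by
  unfold radP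
  have h0 : (0 : ℝ) < 12 * (2 * g + 1) := by positivity
  have := Real.sin_le_one (π * r / 2)
  gcongr; linarith

/-- Upper bound `radP ≤ 1 + 1/(4(2g+1))`. [folklore] -/
theorem radP_le (g : ℕ) (r : ℝ) : radP g r ≤ 1 + 1 / (4 * (2 * g + 1)) := by
  unfold radP
  have h0 : (0 : ℝ) < 2 * g + 1 := by positivity
  have := Real.neg_one_le_sin (π * r / 2)
  have h : (2 - Real.sin (π * r / 2)) / (12 * (2 * g + 1)) ≤ 1 / (4 * (2 * g + 1)) := by
    rw [div_le_div_iff₀ (by positivity) (by positivity)]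
    nlinarith
  linarith

/-- `1 < radP`. [folklore] -/
theorem one_lt_radP (g : ℕ) (r : ℝ) : 1 < radP g r :=
  lt_of_lt_of_le (by have : (0 : ℝ) < 12 * (2 * g + 1) := by positivity
                     linarith [one_div_pos.2 this]) (radP_ge g r)

/-- `0 < radP`. [folklore] -/
theorem radP_pos (g : ℕ) (r : ℝ) : 0 < radP g r := lt_trans one_pos (one_lt_radP g r)

/-- `radP ≤ 1 + 1/(2g+1)` (the strip condition applies). [folklore] -/
theorem radP_le' (g : ℕ) (r : ℝ) : radP g r ≤ 1 + 1 / (2 * g + 1) := by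
  refine (radP_le g r).trans ?_
  have h0 : (0 : ℝ) < 2 * g + 1 := by positivity
  have := one_div_le_one_div_of_le h0 (show (2 * (g : ℝ) + 1) ≤ 4 * (2 * g + 1) by linarith)
  linarith

/-- `radP ≤ 1 + 1/12` for `g ≥ 1`. [folklore] -/
theorem radP_le_thirteen_twelfths (hg : 1 ≤ g) (r : ℝ) : radP g r ≤ 1 + 1 / 12 := by
  refine (radP_le g r).trans ?_
  have hg' : (1 : ℝ) ≤ g := by exact_mod_cast hg
  have := one_div_le_one_div_of_le (by norm_num : (0 : ℝ) < 12) (show (12 : ℝ) ≤ 4 * (2 * g + 1) by nlinarith)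
  linarith

/-- The profile is smooth. [folklore] -/
theorem contDiff_radP (g : ℕ) : ContDiff ℝ ∞ (radP g) := by
  unfold radP; fun_prop

/-- The derivative of the profile: `−π cos(πr/2) / (24(2g+1))`. [folklore] -/
theorem hasDerivAt_radP (g : ℕ) (r : ℝ) :
    HasDerivAt (radP g) (-(Real.cos (π * r / 2) * (π / 2)) / (12 * (2 * g + 1))) r := by
  unfold radP
  have h1 : HasDerivAt (fun r : ℝ => π * r / 2) (π / 2) r := by
    simpa using ((hasDerivAt_id r).const_mul π).div_const 2
  have h2 := (Real.hasDerivAt_sin (π * r / 2)).comp r h1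
  exact ((h2.const_sub 2).div_const _).const_add 1

/-- On `(−1, 1)` the profile has negative derivative. [folklore] -/
theorem deriv_radP_neg (g : ℕ) {r : ℝ} (hr : r ∈ Ioo (-1 : ℝ) 1) : deriv (radP g) r < 0 := by
  rw [(hasDerivAt_radP g r).deriv]
  have hc : 0 < Real.cos (π * r / 2) := by
    refine Real.cos_pos_of_mem_Ioo ⟨?_, ?_⟩ <;> nlinarith [Real.pi_pos, hr.1, hr.2]
  have h0 : (0 : ℝ) < 12 * (2 * g + 1) := by positivity
  exact div_neg_of_neg_of_pos (by nlinarith [Real.pi_pos]) h0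

/-- **The profile is strictly decreasing on `[−1, 1]`.** [folklore] -/
theorem strictAntiOn_radP (g : ℕ) : StrictAntiOn (radP g) (Icc (-1 : ℝ) 1) := by
  intro a ha b hb hab
  unfold radP
  have h0 : (0 : ℝ) < 12 * (2 * g + 1) := by positivity
  have hs : Real.sin (π * a / 2) < Real.sin (π * b / 2) := by
    refine Real.strictMonoOn_sin ⟨?_, ?_⟩ ⟨?_, ?_⟩ ?_ <;>
      nlinarith [Real.pi_pos, ha.1, ha.2, hb.1, hb.2]
  have := div_lt_div_of_pos_right (show 2 - Real.sin (π * b / 2) < 2 - Real.sin (π * a / 2) by linarith) h0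
  linarith

/-- The profile is injective on `[−1, 1]`. [folklore] -/
theorem injOn_radP (g : ℕ) : InjOn (radP g) (Icc (-1 : ℝ) 1) := (strictAntiOn_radP g).injOn

/-! ## §2 The parameter `t = radP r · e^{2πiu}` -/

/-- **The Joukowski parameter** of the chart: `tParam g (u, r) = radP g r · e^{2πiu}`. [folklore] -/
def tParam (g : ℕ) (p : ℝ × ℝ) : ℂ := (radP g p.2 : ℂ) * Complex.exp (((2 * π * p.1 : ℝ) : ℂ) * I)

/-- `‖tParam (u, r)‖ = radP r`. [folklore] -/
theorem norm_tParam (g : ℕ) (p : ℝ × ℝ) : ‖tParam g p‖ = radP g p.2 := by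
  rw [tParam, norm_mul, Complex.norm_real, Complex.norm_exp_ofReal_mul_I, mul_one, Real.norm_eq_abs,
    abs_of_pos (radP_pos g _)]

/-- `1 < ‖tParam p‖`. [folklore] -/
theorem one_lt_norm_tParam (g : ℕ) (p : ℝ × ℝ) : 1 < ‖tParam g p‖ := by
  rw [norm_tParam]; exact one_lt_radP g _

/-- `tParam p ≠ 0`. [folklore] -/
theorem tParam_ne_zero (g : ℕ) (p : ℝ × ℝ) : tParam g p ≠ 0 := fun h => by
  have := one_lt_norm_tParam g p; rw [h, norm_zero] at this; linarith

/-- **The strip condition holds along the chart**: `cos θ_1 < Re jX (tParam p)`. [folklore] -/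
theorem strip_tParam (hg : 1 ≤ g) (p : ℝ × ℝ) : Real.cos (branchAngle g 1) < (jX g (tParam g p)).re :=
  strip_of_norm_le hg (one_lt_norm_tParam g p).le (by rw [norm_tParam]; exact radP_le' g _)

/-- `‖jX (tParam p)‖² < 16/9` (`g ≥ 1`). [folklore] -/
theorem norm_jX_tParam_sq_lt (hg : 1 ≤ g) (p : ℝ × ℝ) : ‖jX g (tParam g p)‖ ^ 2 < 16 / 9 := by
  have h := norm_jX_sq_le g (δ := 1 / 12) (one_lt_norm_tParam g p).le
    (by rw [norm_tParam]; exact radP_le_thirteen_twelfths hg _) (by norm_num)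
  linarith

/-- `jY² = jX^{2g+1} + 1` along the chart. [folklore] -/
theorem jY_sq_tParam (hg : 1 ≤ g) (p : ℝ × ℝ) :
    jY g (tParam g p) ^ 2 = jX g (tParam g p) ^ (2 * g + 1) + 1 :=
  jY_sq hg (tParam_ne_zero g p)

/-- `tParam` is `1`-periodic in `u`. [folklore] -/
theorem tParam_periodic (g : ℕ) (u r : ℝ) : tParam g (u + 1, r) = tParam g (u, r) := by
  unfold tParam
  dsimp only
  rw [show (((2 * π * (u + 1) : ℝ)) : ℂ) * I = ((2 * π * u : ℝ) : ℂ) * I + 2 * π * I by push_cast; ring,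
    Complex.exp_add, Complex.exp_two_pi_mul_I, mul_one]

/-- `tParam (1/4, r) = i · radP r`: the quarter phase is the imaginary axis. [folklore] -/
theorem tParam_quarter (g : ℕ) (r : ℝ) : tParam g (1 / 4, r) = I * radP g r := by
  unfold tParam
  dsimp only
  rw [show (((2 * π * (1 / 4) : ℝ)) : ℂ) * I = π / 2 * I by push_cast; ring, Complex.exp_pi_div_two_mul_I,
    mul_comm]

/-- **`tParam` is injective on `[0, 1) × [−1, 1]`** (norm gives `r`, then the phase gives `u`).
[folklore] -/
theorem tParam_injOn (g : ℕ) : InjOn (tParam g) (Ico (0 : ℝ) 1 ×ˢ Icc (-1 : ℝ) 1) := by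
  rintro ⟨u, r⟩ ⟨hu, hr⟩ ⟨u', r'⟩ ⟨hu', hr'⟩ h
  have hn := congrArg norm h
  rw [norm_tParam, norm_tParam] at hn
  have hrr : r = r' := injOn_radP g hr hr' hn
  subst hrr
  have hρ : ((radP g r : ℝ) : ℂ) ≠ 0 := by exact_mod_cast (radP_pos g r).ne'
  have he : Complex.exp (((2 * π * u : ℝ) : ℂ) * I) = Complex.exp (((2 * π * u' : ℝ) : ℂ) * I) :=
    mul_left_cancel₀ hρ h
  obtain ⟨n, hn'⟩ := Complex.exp_eq_exp_iff_exists_int.1 he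
  have him := congrArg Complex.im hn'
  simp at him
  have hpi : u = u' + n := by
    have := Real.pi_pos
    field_simp at him
    nlinarith [him]
  have hn0 : (n : ℝ) = 0 := by
    have h1 : (-1 : ℝ) < n := by linarith [hu.1, hu.2, hu'.1, hu'.2]
    have h2 : (n : ℝ) < 1 := by linarith [hu.1, hu.2, hu'.1, hu'.2]
    have h1' : (-1 : ℤ) < n := by exact_mod_cast h1
    have h2' : n < 1 := by exact_mod_cast h2
    have : n = 0 := by omega
    exact_mod_cast this
  rw [hn0, add_zero] at hpi
  rw [hpi]

/-- `tParam` is smooth. [folklore] -/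
theorem contDiff_tParam (g : ℕ) : ContDiff ℝ ∞ (tParam g) := by
  unfold tParam
  refine ContDiff.mul (Complex.ofRealCLM.contDiff.comp ((contDiff_radP g).comp contDiff_snd)) ?_
  refine Complex.contDiff_exp.comp ?_
  exact (Complex.ofRealCLM.contDiff.comp (contDiff_const.mul contDiff_fst)).mul contDiff_const

/-- `tParam` is continuous. [folklore] -/
theorem continuous_tParam (g : ℕ) : Continuous (tParam g) := (contDiff_tParam g).continuous

/-- **`∂ᵤ tParam = 2πi · tParam`.** [folklore] -/
theorem hasDerivAt_tParam_u (g : ℕ) (u r : ℝ) :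
    HasDerivAt (fun u' => tParam g (u', r)) (tParam g (u, r) * (2 * π * I)) u := by
  have h1 : HasDerivAt (fun u' : ℝ => (((2 * π * u' : ℝ)) : ℂ) * I) ((2 * π : ℝ) * I) u := by
    have h := ((hasDerivAt_id u).const_mul (2 * π)).ofReal_comp.mul_const I
    simpa using h
  have h2 := h1.cexp.const_mul ((radP g r : ℝ) : ℂ)
  refine h2.congr_deriv ?_
  simp only [tParam]; push_cast; ring

/-- **`∂ᵣ tParam = radP' r · e^{2πiu}`.** [folklore] -/
theorem hasDerivAt_tParam_r (g : ℕ) (u r : ℝ) :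
    HasDerivAt (fun r' => tParam g (u, r'))
      (((deriv (radP g) r : ℝ) : ℂ) * Complex.exp (((2 * π * u : ℝ) : ℂ) * I)) r := by
  have h := ((hasDerivAt_radP g r).ofReal_comp).mul_const (Complex.exp (((2 * π * u : ℝ) : ℂ) * I))
  rw [(hasDerivAt_radP g r).deriv]
  exact h

/-! ## §3 The ambient chart and the chart -/

/-- **The ambient annulus chart** `cycleAmb g c (u, r) = pagePt g c (jX t, jY t)`,
`t = tParam g (u, r)`. [cite: Milnor1968, §9] -/
def cycleAmb (g : ℕ) (c : ℂ) (p : ℝ × ℝ) : EuclideanSpace ℝ (Fin 4) :=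
  pagePt g c (jX g (tParam g p)) (jY g (tParam g p))

/-- The ambient chart lands in `{rho ≤ 1/4}`. [folklore] -/
theorem cycleAmb_mem (hg : 1 ≤ g) (hc : ‖c‖ ≤ 1) (p : ℝ × ℝ) :
    cycleAmb g c p ∈ rho g ⁻¹' Iic (1 / 4 : ℝ) :=
  rho_pagePt_le hc (jY_sq_tParam hg p) (norm_jX_tParam_sq_lt hg p)

/-- **The annulus chart of the vanishing cycle** of `page g c` over the symmetric chord.
[cite: Milnor1968, §9] -/
def cycleChart (hg : 1 ≤ g) (hc : ‖c‖ ≤ 1) : ℝ × ℝ → Base g :=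
  (rho g ⁻¹' Iic (1 / 4 : ℝ)).codRestrict (cycleAmb g c) (cycleAmb_mem hg hc)

/-- The ambient point of the chart. [folklore] -/
@[simp] theorem cycleChart_val (hg : 1 ≤ g) (hc : ‖c‖ ≤ 1) (p : ℝ × ℝ) :
    (cycleChart hg hc p).1 = cycleAmb g c p := rfl

/-- **Sub-goal `helper_cycleChart_mem_page`** (Y4-2c of the model chain (R2) for node N1a of NF4):
the annulus chart of the vanishing cycle takes values in the page `page g c`. [cite: Milnor1968, §9] -/
theorem helper_cycleChart_mem_page : ∀ (g : ℕ) (c : ℂ) (hg : 1 ≤ g) (hc : ‖c‖ ≤ 1) (p : ℝ × ℝ), Summit.SmoothPoincare4.SmoothPoincare4.Theorems.AcyclicBisectionExists.ModpBraidOrbits.cycleChart hg hc p ∈ Literature.Topology.FourManifolds.LefschetzBase.page g c :=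
  fun _ _ hg hc p => basePt_mem_page hc (jY_sq_tParam hg p) (norm_jX_tParam_sq_lt hg p)

/-- The chart takes values in the page. [folklore] -/
theorem cycleChart_mem_page (hg : 1 ≤ g) (hc : ‖c‖ ≤ 1) (p : ℝ × ℝ) : cycleChart hg hc p ∈ page g c :=
  helper_cycleChart_mem_page g c hg hc p

/-- The chart is `1`-periodic. [folklore] -/
theorem cycleChart_periodic (hg : 1 ≤ g) (hc : ‖c‖ ≤ 1) (u r : ℝ) :
    cycleChart hg hc (u + 1, r) = cycleChart hg hc (u, r) := by
  apply Subtype.ext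
  simp only [cycleChart_val, cycleAmb, tParam_periodic]

/-- **The chart is injective on `[0, 1) × [−1, 1]`** (hence on the fundamental strip). [folklore] -/
theorem cycleChart_injOn' (hg : 1 ≤ g) (hc : ‖c‖ ≤ 1) :
    InjOn (cycleChart hg hc) (Ico (0 : ℝ) 1 ×ˢ Icc (-1 : ℝ) 1) := by
  intro p hp q hq h
  have h' := congrArg (fun z : Base g => z.1) h
  simp only [cycleChart_val, cycleAmb] at h'
  obtain ⟨hx, -⟩ := (pagePt_inj hc).1 h'
  rcases (jX_eq_jX_iff hg (tParam_ne_zero g p) (tParam_ne_zero g q)).1 hx with e | e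
  · exact tParam_injOn g hp hq e
  · exfalso
    have h1 := one_lt_norm_tParam g p
    rw [e, norm_inv] at h1
    have h2 := one_lt_norm_tParam g q
    have : ‖tParam g q‖⁻¹ < 1 := inv_lt_one_of_one_lt₀ h2
    linarith

/-- The chart is injective on the fundamental strip `[0, 1) × (−1, 1)`. [folklore] -/
theorem cycleChart_injOn (hg : 1 ≤ g) (hc : ‖c‖ ≤ 1) :
    InjOn (cycleChart hg hc) (Ico (0 : ℝ) 1 ×ˢ Ioo (-1 : ℝ) 1) :=
  (cycleChart_injOn' hg hc).mono (prod_mono le_rfl Ioo_subset_Icc_self)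

/-- **The ambient chart is smooth** (`jX`, `jY` are holomorphic along the chart). [folklore] -/
theorem contDiff_cycleAmb (hg : 1 ≤ g) (c : ℂ) : ContDiff ℝ ∞ (cycleAmb g c) := by
  rw [contDiff_iff_contDiffAt]
  intro p
  unfold cycleAmb pagePt
  refine ContDiffAt.mk₂ (contDiffAt_const.mul ?_) (contDiffAt_const.mul ?_)
  · exact (contDiffAt_jX g (tParam_ne_zero g p)).comp p (contDiff_tParam g).contDiffAt
  · exact (contDiffAt_jY g (tParam_ne_zero g p) (strip_tParam hg p)).comp p (contDiff_tParam g).contDiffAt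

/-- The ambient chart is continuous. [folklore] -/
theorem continuous_cycleAmb (hg : 1 ≤ g) (c : ℂ) : Continuous (cycleAmb g c) :=
  (contDiff_cycleAmb hg c).continuous

/-- **The chart is smooth into the base** (`contMDiff_codRestrict` of the regular domain
`Base g`). [cite: LeeSmoothManifolds2013, Cor. 5.30] -/
theorem contMDiff_cycleChart (hg : 1 ≤ g) (hc : ‖c‖ ≤ 1) :
    ContMDiff 𝓘(ℝ, ℝ × ℝ) (𝓡∂ 4) ∞ (cycleChart hg hc) :=
  (RegularSublevel.halfSliceAtlas (isRegularLevel_rho g)).contMDiff_codRestrict (cycleAmb_mem hg hc)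
    (contDiff_cycleAmb hg c).contMDiff

/-- The chart is continuous. [folklore] -/
theorem continuous_cycleChart (hg : 1 ≤ g) (hc : ‖c‖ ≤ 1) : Continuous (cycleChart hg hc) :=
  Continuous.subtype_mk (continuous_cycleAmb hg c) _

/-- **The core circle of the chart**: a continuous `b : 𝕊¹ → Base g` with
`cycleChart (u, 0) = b (e^{2πiu})`. [folklore] -/
theorem exists_cycleCore (hg : 1 ≤ g) (hc : ‖c‖ ≤ 1) :
    ∃ b : sphere (0 : EuclideanSpace ℝ (Fin 2)) 1 → Base g, Continuous b ∧
      ∀ u : ℝ, cycleChart hg hc (u, 0) = b (circlePt u) := by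
  obtain ⟨b, hb, hbu⟩ := exists_coreCircle (continuous_cycleChart hg hc) (cycleChart_periodic hg hc)
    0 0 1 (Or.inl rfl)
  exact ⟨b, hb, fun u => by rw [hbu u]; simp⟩

end Summit.SmoothPoincare4.SmoothPoincare4.Theorems.AcyclicBisectionExists.ModpBraidOrbits

end
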